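import Literature.Analysis.Asymptotics.PoincareRatioTheorem
import Summits.KontsevichZagierPeriods.Zeta5Search.CertificateMeasure
import HarnessLib

/-!
# ζ(5) search — FORMAT A′ + Poincaré: exact rates and the sharp exponent of a recurrence certificate (cell `pub-zeta5`, TYPER)

HONEST FRAMING: systematic search; no irrationality claim unless certified.

A `RecurrenceCertificate ξ` (`RecurrenceCertificate.lean`, FORMAT A′ of `CRITERIA.md`) proves
`ξ ∉ ℚ` from a ratio BOX `λ ≤ u_{n+1}/uₙ ≤ Λ` and an lcm-denominator margin; its built-in measure
(`CertificateMeasure.lean`) uses the box ends `λ, Λ` and the sup `τ` of `tₙ`, so its exponent is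
far from the truth (Apéry: `≈ 73` instead of `13.42`). When the recurrence is of POINCARÉ type —
`sₙ → a`, `tₙ → b` — the tree's Poincaré theorem under a bracket
(`Literature.Analysis.Asymptotics.PoincareRecurrence.tendsto_ratio_of_recurrence₂`, Elaydi Thm 7.10)
upgrades the box to EXACT limits. This file packages that upgrade once and for all:

* `LimitData R` — the Poincaré data of a certificate `R`: limits `a, b` of `sₙ, tₙ` (over `ℝ`), a
  root `λ∞ ≥ λ` of `x² = a x - b` with the contraction condition `|b| < λ²`;
* `LimitData.tendsto_ratio` — `u_{n+1}/uₙ → λ∞`; `tendsto_log_u_div` — `log uₙ/n → log λ∞`;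
  `tendsto_root_u` — `uₙ^{1/n} → λ∞`; `tendsto_log_abs_v_div` — the numerators have the same rate
  (`vₙ/uₙ → ξ ≠ 0` because `ξ` is irrational by the certificate);
* `tendsto_log_abs_casoratian_div` — `log|Wₙ|/n → log|b|` for the Casoratian (Abel: `W_{n+1} = tₙWₙ`);
* `gap_pos` — `log λ∞ - log b - δ₀ > 0` (`δ₀ = Σ cᵢkᵢ`), from the certificate's margin;
* `sharpCertificate` — for every small `ε > 0` an `ApproximationCertificate ξ` with exponents
  `Q = log λ∞ - ε`, `Q' = log λ∞ + ε`, `w = log b + ε`, `δ = δ₀ + ε` (margin `gap - 5ε`);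
* `not_liouvilleWith_sharp` — hence `¬ LiouvilleWith p ξ` for EVERY
  `p > 1 + (log λ∞ + δ₀)/(log λ∞ - log b - δ₀)`: the irrationality exponent the method really gives
  (Apéry: `1 + (log(17+12√2) + 3)/(log(17+12√2) - 3) = 13.417…`, instantiated in
  `CalibrationAperyRates.lean`).

Everything is PROVED (0 sorry); inputs are the certificate's own fields and the tree's theorems.
-/

noncomputable section

open Filter Topology Finset
open Literature.Analysis.Asymptotics.PoincareRecurrence

namespace Summit.KontsevichZagierPeriods.Zeta5Search

namespace RecurrenceCertificate

variable {ξ : ℝ}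

/-- **Poincaré data of a recurrence certificate**: the coefficients converge, `sₙ → a`, `tₙ → b`,
and `λ∞ ≥ λ` is a root of the limiting characteristic equation `x² = a x - b` with `|b| < λ²`
(contraction of the ratio map on `[λ, ∞)`; then `λ∞` is the dominant root and the only one `≥ λ`). -/
structure LimitData (R : RecurrenceCertificate ξ) where
  /-- the limit `a` of `sₙ` -/
  a : ℝ
  /-- the limit `b` of `tₙ` -/
  b : ℝ
  /-- the dominant characteristic root `λ∞` -/
  lam : ℝ
  /-- `sₙ → a` -/
  tendsto_s : Tendsto (fun n : ℕ => (R.s n : ℝ)) atTop (𝓝 a)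
  /-- `tₙ → b` -/
  tendsto_t : Tendsto (fun n : ℕ => (R.t n : ℝ)) atTop (𝓝 b)
  /-- `λ∞² = a λ∞ - b` -/
  charEq : lam ^ 2 = a * lam - b
  /-- `λ ≤ λ∞` (the certificate's lower box end) -/
  lam_le : (R.lam : ℝ) ≤ lam
  /-- contraction: `|b| < λ²` -/
  contr : |b| < (R.lam : ℝ) ^ 2

namespace LimitData

variable {R : RecurrenceCertificate ξ} (D : LimitData R)

/-- `λ∞ > 0`. -/
theorem lam_pos : 0 < D.lam := R.lam_pos.trans_le D.lam_le

/-- `λ∞ > 1`. -/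
theorem one_lt_lam : 1 < D.lam :=
  lt_of_lt_of_le (by exact_mod_cast R.one_lt_lam) D.lam_le

/-- `log λ∞ > 0`. -/
theorem log_lam_pos : 0 < Real.log D.lam := Real.log_pos D.one_lt_lam

/-! ### Exact growth -/

/-- **Poincaré**: `u_{n+1}/uₙ → λ∞`. -/
theorem tendsto_ratio : Tendsto (fun n : ℕ => (R.u (n + 1) : ℝ) / R.u n) atTop (𝓝 D.lam) := by
  refine tendsto_ratio_of_recurrence₂ (fun n => (R.u n : ℝ)) (fun n => (R.s n : ℝ))
    (fun n => (R.t n : ℝ)) R.N ?_ D.tendsto_s D.tendsto_t R.lam_pos ?_ ?_ D.charEq D.lam_le D.contr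
  · intro n hn; exact_mod_cast R.rec_u n hn
  · intro n hn; exact (R.ratio_bounds n hn).1.ne'
  · intro n hn
    obtain ⟨hpos, hlo, -⟩ := R.ratio_bounds n hn
    rwa [le_div_iff₀ hpos]

/-- `λ∞ ≤ Λ` (the ratios stay in the box). -/
theorem lam_le_Lam : D.lam ≤ R.Lam :=
  le_of_tendsto D.tendsto_ratio (eventually_atTop.2 ⟨R.N, fun n hn => by
    obtain ⟨hpos, -, hup⟩ := R.ratio_bounds n hn
    rwa [div_le_iff₀ hpos]⟩)

/-- **Exact growth rate of the denominators**: `log uₙ / n → log λ∞` (Elaydi's Lemma 7.14). -/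
theorem tendsto_log_u_div :
    Tendsto (fun n : ℕ => Real.log (R.u n : ℝ) / n) atTop (𝓝 (Real.log D.lam)) := by
  have h := tendsto_log_abs_div_of_tendsto_ratio (fun n => (R.u n : ℝ)) R.N
    (fun n hn => (R.ratio_bounds n hn).1.ne') D.lam_pos.ne' D.tendsto_ratio
  rw [abs_of_pos D.lam_pos] at h
  refine h.congr' ?_
  filter_upwards [eventually_ge_atTop R.N] with n hn
  rw [abs_of_pos (R.ratio_bounds n hn).1]

/-- `uₙ^{1/n} → λ∞`. -/
theorem tendsto_root_u : Tendsto (fun n : ℕ => (R.u n : ℝ) ^ (1 / (n : ℝ))) atTop (𝓝 D.lam) := by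
  have h1 := (Real.continuous_exp.tendsto _).comp D.tendsto_log_u_div
  rw [Real.exp_log D.lam_pos] at h1
  refine h1.congr' ?_
  filter_upwards [eventually_ge_atTop R.N] with n hn
  simp only [Function.comp]
  rw [Real.rpow_def_of_pos (R.ratio_bounds n hn).1]
  congr 1
  ring

/-- **The numerators have the same rate**: `log|vₙ|/n → log λ∞` (`vₙ = uₙ · (vₙ/uₙ)`, `vₙ/uₙ → ξ ≠ 0`). -/
theorem tendsto_log_abs_v_div :
    Tendsto (fun n : ℕ => Real.log |(R.v n : ℝ)| / n) atTop (𝓝 (Real.log D.lam)) := by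
  have hξ : ξ ≠ 0 := R.irrational.ne_zero
  have h1 : Tendsto (fun n : ℕ => Real.log |(R.v n : ℝ) / R.u n|) atTop (𝓝 (Real.log |ξ|)) :=
    R.tendsto_div.abs.log (abs_ne_zero.2 hξ)
  have h2 : Tendsto (fun n : ℕ => Real.log |(R.v n : ℝ) / R.u n| / n) atTop (𝓝 0) :=
    h1.div_atTop tendsto_natCast_atTop_atTop
  have h3 := D.tendsto_log_u_div.add h2
  rw [add_zero] at h3
  refine h3.congr' ?_
  filter_upwards [eventually_ge_atTop R.N, R.tendsto_div.eventually_ne hξ] with n hn hne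
  have hu := (R.ratio_bounds n hn).1
  have hq : |(R.v n : ℝ) / R.u n| ≠ 0 := by
    rw [abs_ne_zero]; exact hne
  have e : |(R.v n : ℝ)| = (R.u n : ℝ) * |(R.v n : ℝ) / R.u n| := by
    rw [abs_div, abs_of_pos hu]; field_simp
  rw [e, Real.log_mul hu.ne' hq, add_div]

/-! ### The Casoratian and the limit `b` -/

/-- `b ≥ 0` (`tₙ > 0`). -/
theorem b_nonneg : 0 ≤ D.b :=
  ge_of_tendsto D.tendsto_t (eventually_atTop.2 ⟨R.N, fun n hn => by exact_mod_cast (R.t_pos n hn).le⟩)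

/-- `b ≤ τ`. -/
theorem b_le_tau : D.b ≤ R.tau :=
  le_of_tendsto D.tendsto_t (eventually_atTop.2 ⟨R.N, fun n hn => by exact_mod_cast R.t_le n hn⟩)

/-- Abel, one step, over `ℝ`: `W_{n+1} = tₙ Wₙ` for `n ≥ N`. -/
theorem _root_.Summit.KontsevichZagierPeriods.Zeta5Search.RecurrenceCertificate.casoratian_succ_real
    (R : RecurrenceCertificate ξ) (n : ℕ) (hn : R.N ≤ n) :
    (R.u (n + 1) : ℝ) * R.v (n + 2) - R.u (n + 2) * R.v (n + 1) =
      (R.t n : ℝ) * ((R.u n : ℝ) * R.v (n + 1) - R.u (n + 1) * R.v n) := by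
  have h := casoratian_succ R.u R.v R.s R.t n (R.rec_u n hn) (R.rec_v n hn)
  exact_mod_cast h

/-- The Casoratian is non-zero over `ℝ` for `n ≥ N`. -/
theorem _root_.Summit.KontsevichZagierPeriods.Zeta5Search.RecurrenceCertificate.casoratian_real_ne_zero
    (R : RecurrenceCertificate ξ) (n : ℕ) (hn : R.N ≤ n) :
    (R.u n : ℝ) * R.v (n + 1) - R.u (n + 1) * R.v n ≠ 0 := by
  have h := R.casoratian_ne_zero n hn
  exact_mod_cast h

/-- **Exact rate of the Casoratian**: `log|Wₙ|/n → log|b|` when `b ≠ 0` (`W_{n+1}/Wₙ = tₙ → b`). -/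
theorem tendsto_log_abs_casoratian_div (hb : D.b ≠ 0) :
    Tendsto (fun n : ℕ => Real.log |(R.u n : ℝ) * R.v (n + 1) - R.u (n + 1) * R.v n| / n) atTop
      (𝓝 (Real.log |D.b|)) := by
  refine tendsto_log_abs_div_of_tendsto_ratio
    (fun n => (R.u n : ℝ) * R.v (n + 1) - R.u (n + 1) * R.v n) R.N
    (fun n hn => R.casoratian_real_ne_zero n hn) hb ?_
  refine D.tendsto_t.congr' ?_
  filter_upwards [eventually_ge_atTop R.N] with n hn
  rw [show n + 1 + 1 = n + 2 by ring, R.casoratian_succ_real n hn,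
    mul_div_cancel_right₀ _ (R.casoratian_real_ne_zero n hn)]

/-- **The rate gap is positive**: `log λ∞ - log b - δ₀ > 0` (`≥ η`, the certificate's margin, since
`λ ≤ λ∞`, `b ≤ τ`, `λ ≤ Λ`). -/
theorem gap_pos (hb : 0 < D.b) : 0 < Real.log D.lam - Real.log D.b - R.denomRate₀ := by
  have h1 : Real.log (R.lam : ℝ) ≤ Real.log D.lam := Real.log_le_log R.lam_pos D.lam_le
  have h2 : Real.log D.b ≤ Real.log (R.tau : ℝ) := Real.log_le_log hb D.b_le_tau
  have h3 : Real.log (R.lam : ℝ) ≤ Real.log (R.Lam : ℝ) :=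
    Real.log_le_log R.lam_pos (by exact_mod_cast R.lam_le)
  have h4 := R.eta_pos
  unfold eta at h4
  linarith

/-! ### The sharp approximation certificate and the exponent -/

/-- Eventually `e^{(log λ∞ - ε) n} ≤ uₙ`. -/
theorem eventually_exp_le_u {ε : ℝ} (hε : 0 < ε) :
    ∀ᶠ n : ℕ in atTop, Real.exp ((Real.log D.lam - ε) * n) ≤ (R.u n : ℝ) := by
  filter_upwards [D.tendsto_log_u_div.eventually (lt_mem_nhds (show Real.log D.lam - ε < Real.log D.lam
    by linarith)), eventually_ge_atTop R.N, eventually_ge_atTop 1] with n hn hN h1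
  have hu := (R.ratio_bounds n hN).1
  have hn0 : (0 : ℝ) < n := by exact_mod_cast h1
  rw [lt_div_iff₀ hn0] at hn
  exact ((Real.lt_log_iff_exp_lt hu).1 hn).le

/-- Eventually `uₙ ≤ e^{(log λ∞ + ε) n}`. -/
theorem eventually_u_le_exp {ε : ℝ} (hε : 0 < ε) :
    ∀ᶠ n : ℕ in atTop, (R.u n : ℝ) ≤ Real.exp ((Real.log D.lam + ε) * n) := by
  filter_upwards [D.tendsto_log_u_div.eventually (gt_mem_nhds (show Real.log D.lam < Real.log D.lam + ε
    by linarith)), eventually_ge_atTop R.N, eventually_ge_atTop 1] with n hn hN h1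
  have hu := (R.ratio_bounds n hN).1
  have hn0 : (0 : ℝ) < n := by exact_mod_cast h1
  rw [div_lt_iff₀ hn0] at hn
  exact ((Real.log_lt_iff_lt_exp hu).1 hn).le

/-- Eventually `|Wₙ| ≤ e^{(log b + ε) n}` (`b > 0`). -/
theorem eventually_abs_casoratian_le (hb : 0 < D.b) {ε : ℝ} (hε : 0 < ε) :
    ∀ᶠ n : ℕ in atTop, |((R.u n * R.v (n + 1) - R.u (n + 1) * R.v n : ℚ) : ℝ)| ≤
      1 * Real.exp ((Real.log D.b + ε) * n) := by
  have h := D.tendsto_log_abs_casoratian_div hb.ne'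
  rw [abs_of_pos hb] at h
  filter_upwards [h.eventually (gt_mem_nhds (show Real.log D.b < Real.log D.b + ε by linarith)),
    eventually_ge_atTop R.N, eventually_ge_atTop 1] with n hn hN h1
  have hW := abs_pos.2 (R.casoratian_real_ne_zero n hN)
  have hn0 : (0 : ℝ) < n := by exact_mod_cast h1
  rw [div_lt_iff₀ hn0] at hn
  push_cast
  rw [one_mul]
  exact ((Real.log_lt_iff_lt_exp hW).1 hn).le

/-- **The sharp certificate.** For `b > 0` and `0 < ε` with `5ε < log λ∞ - log b - δ₀`, `ε < log λ∞`:
an `ApproximationCertificate ξ` with exponents `Q = log λ∞ - ε`, `Q' = log λ∞ + ε`, `K = 1`,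
`w = log b + ε`, `δ = δ₀ + ε` on the certificate's own data `u, v, Dₙ = ∏ lcm(1..cᵢn)^{kᵢ}`. -/
def sharpCertificate (hb : 0 < D.b) {ε : ℝ} (hε : 0 < ε)
    (h5 : 5 * ε < Real.log D.lam - Real.log D.b - R.denomRate₀) (hεl : ε < Real.log D.lam) :
    ApproximationCertificate ξ where
  u := R.u
  v := R.v
  denom n := ∏ i, Nat.lcmUpto (R.c i * n) ^ R.k i
  growthLow := Real.log D.lam - ε
  growthUp := Real.log D.lam + ε
  casoratiConst := 1
  casoratiRate := Real.log D.b + ε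
  denomRate := R.denomRate₀ + ε
  growthLow_pos := by linarith
  denom_pos n := prod_lcmUpto_pow_pos R.c R.k n
  isInt_u := eventually_atTop.2 ⟨R.N, R.isInt_u⟩
  isInt_v := eventually_atTop.2 ⟨R.N, R.isInt_v⟩
  growth_lower := D.eventually_exp_le_u hε
  growth_upper := D.eventually_u_le_exp hε
  casorati_le := D.eventually_abs_casoratian_le hb hε
  casorati_ne := Eventually.frequently (eventually_atTop.2 ⟨R.N, R.casoratian_ne_zero⟩)
  tendsto_div := R.tendsto_div
  denom_le := by
    filter_upwards [eventually_prod_lcmUpto_pow_le_exp R.c R.k hε] with n hn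
    unfold denomRate₀
    exact_mod_cast hn
  margin := by linarith

/-- The exponent of the sharp certificate is `1 + (log λ∞ + δ₀ + 2ε)/(log λ∞ - log b - δ₀ - 5ε)`. -/
theorem exponent_sharpCertificate (hb : 0 < D.b) {ε : ℝ} (hε : 0 < ε)
    (h5 : 5 * ε < Real.log D.lam - Real.log D.b - R.denomRate₀) (hεl : ε < Real.log D.lam) :
    ((D.sharpCertificate hb hε h5 hεl).growthUp + (D.sharpCertificate hb hε h5 hεl).denomRate) /
        (D.sharpCertificate hb hε h5 hεl).marginValue + 1 =
      (Real.log D.lam + R.denomRate₀ + 2 * ε) / (Real.log D.lam - Real.log D.b - R.denomRate₀ - 5 * ε)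
        + 1 := by
  simp only [ApproximationCertificate.marginValue, sharpCertificate]
  ring

/-- **The sharp exponent.** If the certificate's recurrence is of Poincaré type with `tₙ → b > 0`,
then `¬ LiouvilleWith p ξ` for every `p > 1 + (log λ∞ + δ₀)/(log λ∞ - log b - δ₀)` — the
irrationality exponent of `ξ` is at most `1 + (log λ∞ + δ₀)/(log λ∞ - log b - δ₀)`. -/
theorem not_liouvilleWith_sharp (hb : 0 < D.b) {expo : ℝ}
    (hexpo : 1 + (Real.log D.lam + R.denomRate₀) / (Real.log D.lam - Real.log D.b - R.denomRate₀) <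
      expo) : ¬ LiouvilleWith expo ξ := by
  set A : ℝ := Real.log D.lam + R.denomRate₀ with hA
  set B : ℝ := Real.log D.lam - Real.log D.b - R.denomRate₀ with hB
  have hB0 : 0 < B := D.gap_pos hb
  have hlog := D.log_lam_pos
  -- the exponent `g ε = (A + 2ε)/(B - 5ε) + 1` is continuous at `ε = 0` with value `< expo`
  have hg : Tendsto (fun ε : ℝ => (A + 2 * ε) / (B - 5 * ε) + 1) (𝓝 0)
      (𝓝 ((A + 2 * 0) / (B - 5 * 0) + 1)) := by
    refine Tendsto.add (Tendsto.div ?_ ?_ (by simp; exact hB0.ne')) tendsto_const_nhds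
    · exact tendsto_const_nhds.add (tendsto_id.const_mul 2)
    · exact tendsto_const_nhds.sub (tendsto_id.const_mul 5)
  have hval : (A + 2 * 0) / (B - 5 * 0) + 1 < expo := by simpa [add_comm] using hexpo
  have hev : ∀ᶠ ε : ℝ in 𝓝[>] 0, (A + 2 * ε) / (B - 5 * ε) + 1 < expo ∧ 5 * ε < B ∧
      ε < Real.log D.lam := by
    have e1 : ∀ᶠ ε : ℝ in 𝓝 0, (A + 2 * ε) / (B - 5 * ε) + 1 < expo :=
      hg.eventually (gt_mem_nhds hval)
    have e2 : ∀ᶠ ε : ℝ in 𝓝 0, 5 * ε < B := by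
      have : Tendsto (fun ε : ℝ => 5 * ε) (𝓝 0) (𝓝 (5 * 0)) := tendsto_id.const_mul 5
      rw [mul_zero] at this
      exact this.eventually (gt_mem_nhds hB0)
    have e3 : ∀ᶠ ε : ℝ in 𝓝 0, ε < Real.log D.lam := eventually_lt_nhds hlog
    exact nhdsWithin_le_nhds (e1.and (e2.and e3))
  obtain ⟨ε, ⟨hlt, h5, hεl⟩, hε⟩ := (hev.and self_mem_nhdsWithin).exists
  have hcert := (D.sharpCertificate hb hε h5 hεl).not_liouvilleWith
    (eventually_atTop.2 ⟨R.N, R.casoratian_ne_zero⟩) (expo := expo)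
    (by rw [D.exponent_sharpCertificate hb hε h5 hεl]; exact hlt)
  exact hcert

end LimitData

end RecurrenceCertificate

end Summit.KontsevichZagierPeriods.Zeta5Search
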